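import Summits.SmoothPoincare4.SmoothPoincare4.Theses.EntropyRung
import Literature.Geometry.Lorentzian.ConformalChangeFour
import Literature.Geometry.Lorentzian.ConformalVolume
import Literature.Geometry.Lorentzian.EnergyCurrents
import Literature.Geometry.Lorentzian.LeviCivitaProofs
import Literature.Geometry.Lorentzian.VolumeProofs
import Literature.Geometry.Riemannian.RiemannianDistance
import HarnessLib

/-!
# Realising `ψ² g` and transporting Perelman's `𝒲`-clause (the conformal law for `𝒲` in
# dimension four)
(stub `stub_conformalRealisation`, Stub E of line `green-blowup-conformal-entropy`, crux
`EntropyRung.SubcylindricalExistence`, item stmt-SmoothPoincare4-10871)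

For a smooth Riemannian metric `g` (Levi-Civita connection) on a closed smooth `4`-manifold of
the summit binder (model `ℝ⁴ = EuclideanSpace ℝ (Fin 4)`, `I = 𝓡 4`) and a smooth `ψ > 0` with
`L_g ψ := R_g ψ − 6 □_g ψ > 0`: if the `𝒲`-clause of `ψ² g` WRITTEN ON `g` (weights `ψ⁴ dV_g`,
curvature `ψ⁻³ L_g ψ`, gradient square `ψ⁻² |∇f|²_g`) holds at level `c` with a gap `δ > 0`, then
the conformal metric `g' = ψ² g` is a smooth Riemannian metric with Levi-Civita connection,
`R_{g'} > 0`, and it satisfies the crux's own clause at level `c` with the same gap.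

Proof: `g'_x = ψ(x)² g_x` is a smooth symmetric positive definite section
(`ContMDiff.smul_section`, as `InitialDataSet.conformal` of `Lorentzian/PositiveMassConformal.lean`);
`g'.HasLeviCivita` is `PseudoRiemannianMetric.hasLeviCivita`; the three dimension-four laws are
`R_{g'} = ψ⁻³ (R_g ψ − 6 □_g ψ)` (`scalarCurvature_conformal_sq_four`, `ConformalChangeFour.lean`),
`dV_{g'} = ψ⁴ dV_g` (`riemannianMeasure_eq_withDensity_of_conformal_sq_four`, `ConformalVolume.lean`)
and `|∇f|²_{g'} = ψ⁻² |∇f|²_g` (`♯_{ψ²g} = ψ⁻² ♯_g`, proved below from `val_sharp_apply` and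
`flat_injective`); both integrals of the clause are then rewritten with Mathlib's
`integral_withDensity_eq_integral_toReal_smul` and matched pointwise by `ring`.
Everything is proved; no definition, no named fact.

References: T. Aubin, *Nonlinear Analysis on Manifolds* (1982), Ch. 6, §6.3 eq. (1), §6.4
[Aubin1982]; A. L. Besse, *Einstein Manifolds* (1987), Thm. 1.159 [Besse1987]; B. O'Neill,
*Semi-Riemannian geometry* (1983), Ch. 3, p. 60 [ONeill1983].
-/

noncomputable section

-- the registered namespace `Summit.SmoothPoincare4.SmoothPoincare4.Theorems` repeats a component
set_option linter.dupNamespace false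

open scoped Manifold ContDiff Topology ENNReal NNReal
open Set Filter MeasureTheory
open Literature.Geometry.Lorentzian Literature.Geometry.Riemannian

namespace Summit.SmoothPoincare4.SmoothPoincare4.Theorems

namespace ConformalRealisation

open Literature.Geometry.Lorentzian.PseudoRiemannianMetric

/-! ## The conformal metric `ψ² g` and the law `♯_{φ g} = φ⁻¹ ♯_g` -/

section Metric

variable {E : Type*} [NormedAddCommGroup E] [NormedSpace ℝ E] [FiniteDimensional ℝ E]
  {H : Type*} [TopologicalSpace H] {I : ModelWithCorners ℝ E H}
  {M : Type*} [TopologicalSpace M] [ChartedSpace H M] [IsManifold I ∞ M]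

omit [FiniteDimensional ℝ E] in
/-- **The conformal metric `ψ² g`.** For a smooth Riemannian `g` on `TM` and a smooth `ψ > 0`
there is a smooth Riemannian pseudo-Riemannian metric `g'` with `g'_x(v, w) = ψ(x)² g_x(v, w)`:
the section `x ↦ ψ(x)² g_x` is symmetric, positive definite (hence nondegenerate) and smooth
(`ContMDiff.smul_section`), exactly as `InitialDataSet.conformal` (`PositiveMassConformal.lean`)
with `φ⁴`. Aubin 1982, Ch. 6, §6.3. [folklore] -/
theorem exists_isRiemannian_conformal_sq
    (g : PseudoRiemannianMetric I ∞ E (TangentSpace I : M → Type _)) (hg : g.IsRiemannian)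
    {ψ : M → ℝ} (hψ : ContMDiff I 𝓘(ℝ) ∞ ψ) (hpos : ∀ x, 0 < ψ x) :
    ∃ g' : PseudoRiemannianMetric I ∞ E (TangentSpace I : M → Type _),
      g'.IsRiemannian ∧
        ∀ (x : M) (v w : TangentSpace I x), g'.val x v w = ψ x ^ 2 * g.val x v w := by
  have h2 : ContMDiff I 𝓘(ℝ) ∞ (fun x ↦ ψ x ^ 2) := (contDiff_id.pow 2).comp_contMDiff hψ
  refine ⟨{ val := fun x ↦ (ψ x ^ 2) • g.val x
            symm := fun x v w ↦ ?_
            nondegenerate := fun x v hv ↦ ?_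
            contMDiff := h2.smul_section g.contMDiff }, fun x v hv ↦ ?_, fun x v w ↦ rfl⟩
  · change ψ x ^ 2 * g.val x v w = ψ x ^ 2 * g.val x w v
    rw [g.symm x v w]
  · by_contra h
    have h1 : 0 < ψ x ^ 2 * g.val x v v := mul_pos (pow_pos (hpos x) 2) (hg x v h)
    exact h1.ne' (hv v)
  · change 0 < ψ x ^ 2 * g.val x v v
    exact mul_pos (pow_pos (hpos x) 2) (hg x v hv)

variable {n : ℕ∞ω}

/-- **`♯` of a conformal metric**: if `g'_x = φ(x) g_x` with `φ(x) ≠ 0` then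
`♯_{g'} α = φ(x)⁻¹ ♯_g α` (from the defining property `g'(♯α, w) = α w` and injectivity of `♭`).
O'Neill 1983, Ch. 3, p. 60. [folklore] -/
theorem sharp_of_conformal (g g' : PseudoRiemannianMetric I n E (TangentSpace I : M → Type _))
    {φ : M → ℝ} (hconf : ∀ (x : M) (v w : TangentSpace I x), g'.val x v w = φ x * g.val x v w)
    {x : M} (hφ : φ x ≠ 0) (α : Module.Dual ℝ (TangentSpace I x)) :
    g'.sharp x α = (φ x)⁻¹ • g.sharp x α := by
  apply g'.flat_injective x
  rw [flat_sharp, map_smul]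
  refine LinearMap.ext fun w ↦ ?_
  rw [LinearMap.smul_apply, flat_apply, hconf, val_sharp_apply, smul_eq_mul,
    inv_mul_cancel_left₀ hφ]

/-- **The gradient square of a conformal metric**: if `g'_x = φ(x) g_x` with `φ(x) ≠ 0` then
`|df|²_{g'}(x) = φ(x)⁻¹ |df|²_g(x)` (`g'⁻¹ = φ⁻¹ g⁻¹` on covectors). For `φ = ψ²` in dimension
four this is the law `|∇f|²_{ψ²g} = ψ⁻² |∇f|²_g` of the conformal bookkeeping of Perelman's `𝒲`.
Aubin 1982, Ch. 6, §6.3. [folklore] -/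
theorem gradSq_of_conformal (g g' : PseudoRiemannianMetric I n E (TangentSpace I : M → Type _))
    {φ : M → ℝ} (hconf : ∀ (x : M) (v w : TangentSpace I x), g'.val x v w = φ x * g.val x v w)
    {x : M} (hφ : φ x ≠ 0) (f : M → ℝ) :
    g'.gradSq f x = (φ x)⁻¹ * g.gradSq f x := by
  rw [gradSq_eq, gradSq_eq, sharp_of_conformal g g' hconf hφ, map_smul, smul_eq_mul]

end Metric

end ConformalRealisation

/-- **Stub E — realising `ψ² g` and transporting the clause (conformal law for `𝒲`)**
(registered stub `stub_conformalRealisation` of line `green-blowup-conformal-entropy`). For a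
smooth Riemannian `g` with Levi-Civita connection on a closed smooth `4`-manifold of the summit
binder and a smooth `ψ > 0` with `R_g ψ − 6 □_g ψ > 0`: if the `𝒲`-clause of `ψ² g` written on
`g` (`dV' = ψ⁴ dV_g`, `R' = ψ⁻³ (R_g ψ − 6 □_g ψ)`, `|∇f|²' = ψ⁻² |∇f|²_g`) holds at level `c`
with a gap `δ > 0`, then there is a smooth Riemannian `g'` with Levi-Civita connection,
`g' = ψ² g` pointwise, `R_{g'} > 0` everywhere, satisfying the crux's own clause at level `c`.
Assembled from `ConformalRealisation.exists_isRiemannian_conformal_sq`,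
`PseudoRiemannianMetric.hasLeviCivita`, `scalarCurvature_conformal_sq_four`,
`riemannianMeasure_eq_withDensity_of_conformal_sq_four`,
`ConformalRealisation.gradSq_of_conformal` and `integral_withDensity_eq_integral_toReal_smul`.
[cite: Aubin1982, Ch. 6, §6.3, eq. (1) and §6.4] -/
theorem stub_conformalRealisation :
    ∀ (M : Type) [TopologicalSpace M] [T2Space M] [SecondCountableTopology M]
      [ChartedSpace (EuclideanSpace ℝ (Fin 4)) M] [IsManifold (𝓡 4) ∞ M] [CompactSpace M]
      [T3Space M] [MeasurableSpace M] [BorelSpace M]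
      (g : PseudoRiemannianMetric (𝓡 4) ∞ (EuclideanSpace ℝ (Fin 4)) (TangentSpace (𝓡 4) : M → Type _))
      [g.HasLeviCivita] (hg : g.IsRiemannian) (ψ : M → ℝ),
      ContMDiff (𝓡 4) 𝓘(ℝ, ℝ) ∞ ψ → (∀ x, 0 < ψ x) →
      (∀ x, 0 < g.scalarCurvature x * ψ x - 6 * g.dalembertian ψ x) →
      ∀ c : ℝ,
        (∃ δ : ℝ, 0 < δ ∧ ∀ τ : ℝ, 0 < τ → ∀ f : M → ℝ, ContMDiff (𝓡 4) 𝓘(ℝ, ℝ) ∞ f →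
          ∫ x, (4 * Real.pi * τ) ^ (-(4 : ℝ) / 2) * Real.exp (-f x) * ψ x ^ 4
              ∂(riemannianMeasure (g.toContMDiffRiemannianMetric hg)) = 1 →
            c + δ ≤
              ∫ x, (τ * ((ψ x ^ 3)⁻¹ * (g.scalarCurvature x * ψ x - 6 * g.dalembertian ψ x) +
                    (ψ x ^ 2)⁻¹ * g.gradSq f x) + f x - 4) *
                  ((4 * Real.pi * τ) ^ (-(4 : ℝ) / 2) * Real.exp (-f x)) * ψ x ^ 4
                ∂(riemannianMeasure (g.toContMDiffRiemannianMetric hg))) →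
        ∃ g' : PseudoRiemannianMetric (𝓡 4) ∞ (EuclideanSpace ℝ (Fin 4)) (TangentSpace (𝓡 4) : M → Type _),
        ∃ _ : g'.HasLeviCivita, ∃ hg' : g'.IsRiemannian,
          (∀ (x : M) (v w : TangentSpace (𝓡 4) x), g'.val x v w = ψ x ^ 2 * g.val x v w) ∧
          (∀ x : M, 0 < g'.scalarCurvature x) ∧
          ∃ δ : ℝ, 0 < δ ∧ ∀ τ : ℝ, 0 < τ → ∀ f : M → ℝ, ContMDiff (𝓡 4) 𝓘(ℝ, ℝ) ∞ f →
            ∫ x, (4 * Real.pi * τ) ^ (-(4 : ℝ) / 2) * Real.exp (-f x)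
                ∂(riemannianMeasure (g'.toContMDiffRiemannianMetric hg')) = 1 →
              c + δ ≤
                ∫ x, (τ * (g'.scalarCurvature x + g'.gradSq f x) + f x - 4) *
                    ((4 * Real.pi * τ) ^ (-(4 : ℝ) / 2) * Real.exp (-f x))
                  ∂(riemannianMeasure (g'.toContMDiffRiemannianMetric hg')) := by
  intro M _ _ _ _ _ _ _ _ _ g _ hg ψ hψ hψpos hL c hW
  -- Step 1: the metric `g' = ψ² g`, Riemannian, with its Levi-Civita connection
  obtain ⟨g', hg', hval⟩ :=
    ConformalRealisation.exists_isRiemannian_conformal_sq g hg hψ hψpos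
  haveI hLC' : g'.HasLeviCivita := g'.hasLeviCivita
  -- Step 2: `R_{g'} = ψ⁻³ (R_g ψ − 6 □_g ψ) > 0`
  have hE : Module.finrank ℝ (EuclideanSpace ℝ (Fin 4)) = 4 := finrank_euclideanSpace_fin
  have hR : ∀ x, g'.scalarCurvature x =
      (ψ x ^ 3)⁻¹ * (g.scalarCurvature x * ψ x - 6 * g.dalembertian ψ x) :=
    PseudoRiemannianMetric.scalarCurvature_conformal_sq_four hE g g' hψ hψpos hval
  have hRpos : ∀ x, 0 < g'.scalarCurvature x := fun x ↦ by
    rw [hR x]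
    exact mul_pos (inv_pos.2 (pow_pos (hψpos x) 3)) (hL x)
  -- Step 3: `|∇f|²_{g'} = ψ⁻² |∇f|²_g`
  have hgrad : ∀ (f : M → ℝ) (x : M), g'.gradSq f x = (ψ x ^ 2)⁻¹ * g.gradSq f x := fun f x ↦
    ConformalRealisation.gradSq_of_conformal g g' (φ := fun y ↦ ψ y ^ 2) hval
      (pow_pos (hψpos x) 2).ne' f
  -- Step 4: `dV_{g'} = ψ⁴ dV_g`
  set μ : Measure M := riemannianMeasure (g.toContMDiffRiemannianMetric hg) with hμ
  have hvol : riemannianMeasure (g'.toContMDiffRiemannianMetric hg') =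
      μ.withDensity fun x ↦ ENNReal.ofReal (ψ x ^ 4) :=
    riemannianMeasure_eq_withDensity_of_conformal_sq_four (g'.toContMDiffRiemannianMetric hg')
      (g.toContMDiffRiemannianMetric hg) hψ.continuous.measurable fun x v w ↦ by
        rw [PseudoRiemannianMetric.toContMDiffRiemannianMetric_inner,
          PseudoRiemannianMetric.toContMDiffRiemannianMetric_inner, hval]
  have hmeas : Measurable fun x ↦ ENNReal.ofReal (ψ x ^ 4) :=
    ENNReal.measurable_ofReal.comp (hψ.continuous.pow 4).measurable
  have hlt : ∀ᵐ x ∂μ, ENNReal.ofReal (ψ x ^ 4) < ⊤ := ae_of_all _ fun _ ↦ ENNReal.ofReal_lt_top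
  have htoReal : ∀ x, (ENNReal.ofReal (ψ x ^ 4)).toReal = ψ x ^ 4 := fun x ↦
    ENNReal.toReal_ofReal (by positivity)
  -- Step 5: assemble
  obtain ⟨δ, hδ, hWδ⟩ := hW
  refine ⟨g', hLC', hg', hval, hRpos, δ, hδ, fun τ hτ f hf hnorm ↦ ?_⟩
  rw [hvol, integral_withDensity_eq_integral_toReal_smul hmeas hlt] at hnorm
  rw [hvol, integral_withDensity_eq_integral_toReal_smul hmeas hlt]
  have hnorm' : ∫ x, (4 * Real.pi * τ) ^ (-(4 : ℝ) / 2) * Real.exp (-f x) * ψ x ^ 4 ∂μ = 1 := by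
    rw [← hnorm]
    refine integral_congr_ae (ae_of_all _ fun x ↦ ?_)
    dsimp only
    rw [htoReal x, smul_eq_mul]
    ring
  refine (hWδ τ hτ f hf hnorm').trans_eq ?_
  refine integral_congr_ae (ae_of_all _ fun x ↦ ?_)
  dsimp only
  rw [htoReal x, smul_eq_mul, hR x, hgrad f x]
  ring

end Summit.SmoothPoincare4.SmoothPoincare4.Theorems

end
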